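import Literature.AlgebraicGeometry.Motives.SeesawChartSections
import Literature.AlgebraicGeometry.Modules.AffineTestObjects
import HarnessLib

/-!
# The (1b) adapter, chart layer: test objects `Spec B → Spec A → U ⊆ W`, ring identifications `εB : B ≅ Γ(Spec B, 𝒪)`,
# finite affine Čech covers of `X × Spec A`, and sections of an isomorphic module as `SecMod`

Chart-level plumbing of the kernel representation `H0KernelRepr` ([MumfordAV1970] §5, Lemmas 1–2 and Cor. 2, pp. 46–50:
«the Grothendieck complex represents `B ↦ H⁰(X_B, L_B)` on `A`-algebras»; [GortzWedhorn2023] Cor. 23.135) for the seesaw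
chart `U ⊆ W`, `A = Γ(W, U)` (★ `Motives.SeesawChartSections`: `specTest`, `FB`, `H0`, `H0map`, `toTopRing`) against the
affine test objects of ★ `Modules.AffineTestObjects` (`testMap`, `testMod`, `testRingHom`, `testModCompIso`, `pullSec`,
`testAlgHom`; `SecMod`, `baseToTotal`):
* unapplied forms `SecMod.val_fun_eq` / `SecMod.mk_fun_eq` / `pullSec_def` / `testAlgHom_apply` (kernel-cheap `rfl`s);
* generic instances over a field: `flat_hom_of_field`, `universallyOpen_hom_of_isProper`, `isSeparated_tensor_left`, and a
  finite affine cover with affine finite intersections of `P ×_K T` (`exists_affine_cechCover`);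
* the chart test objects: `εR : B ≃+* Γ(Spec B, 𝒪)` (inverse of Mathlib's `ΓSpecIso`) with `toTopRing = baseToTotal ∘ εB`,
  `jTest : Spec B → Spec A` over `W`, the naturalities `εR_algebraMap` / `εR_natural` (against `testRingHom`), and the
  whiskered composition identities behind `FBIso`; noetherianity of the chart ring (`isNoetherianRing_chart`, `…_ΓSpec_chart`,
  `isLocallyNoetherian_specTest_chart`);
* `secModOfIso : Γ(N, ⊤) ≃+ SecMod M ρ ⊤` along `M ≅ N`, with its `ρ`-semilinearity (`secModOfIso_smul`).
Everything is proved; no named facts, no `sorry`. Cell `hodgecm-mathlib`, M13 node N1 (1b) §5 adapter — author B-p04 (g15)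
(`N1k-KernelReprAdapter.v1` a316b242, PART D + PART B §B1–§B4), cut for the tree by B-p20 (g8) (B-plan1 R149).
HC_CM is proved only modulo the 7 printed citations until rung 0 closes.

## References
* [MumfordAV1970] D. Mumford, *Abelian Varieties*, TIFR Studies in Mathematics 5 (1970), §5, Lemmas 1–2, Cor. 2 (pp. 46–50).
* [GortzWedhorn2023] U. Görtz, T. Wedhorn, *Algebraic Geometry II: Cohomology of Schemes* (2023), Cor. 23.135 (p. 355), (23.28.5).
-/

set_option autoImplicit false

noncomputable section

set_option backward.isDefEq.respectTransparency false

universe u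

open CategoryTheory CategoryTheory.Limits AlgebraicGeometry MonoidalCategory CartesianMonoidalCategory
  Opposite TopologicalSpace
open scoped TensorProduct

namespace Literature.AlgebraicGeometry.Modules

open Literature.AlgebraicGeometry.Motives

/-! ### Unapplied forms of `pullSec` / `testAlgHom` / `SecMod.val` / `SecMod.mk` (★ `Modules.AffineTestObjects`) -/

section UnappliedForms

/-- `SecMod.val` is the identity (unapplied form). [cite: GortzWedhorn2023, Cor. 23.135 (p. 355)] -/
theorem SecMod.val_fun_eq {Y : Scheme.{u}} {A : Type u} [CommRing A] (L : Y.Modules)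
    (ρ : A →+* Γ(Y, (⊤ : Y.Opens))) (U : Y.Opens) :
    (fun x : SecMod L ρ U => SecMod.val x) = fun x => (x : Γ(L, U)) := rfl

/-- `SecMod.mk` is the identity (unapplied form). [cite: GortzWedhorn2023, Cor. 23.135 (p. 355)] -/
theorem SecMod.mk_fun_eq {Y : Scheme.{u}} {A : Type u} [CommRing A] (L : Y.Modules)
    (ρ : A →+* Γ(Y, (⊤ : Y.Opens))) (U : Y.Opens) :
    (fun x : Γ(L, U) => (SecMod.mk x : SecMod L ρ U)) = fun x => x := rfl

variable {K : Type u} [Field K] (P T : SchemeOver K) [IsAffine T.left]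
variable (L : (P ⊗ T).left.Modules)
variable {T' T'' : SchemeOver K} [IsAffine T'.left] [IsAffine T''.left] (j' : T' ⟶ T) (j'' : T'' ⟶ T)
  (k : T'' ⟶ T') (hk : k ≫ j' = j'')

omit [IsAffine T.left] [IsAffine T'.left] [IsAffine T''.left] in
/-- B-p10's `pullSec` unfolded (unapplied form). [cite: GortzWedhorn2023, Cor. 23.135 (p. 355)] -/
theorem pullSec_def : pullSec P T L j' j'' k hk = fun x =>
    SecMod.mk (((testModCompIso P T L j' j'' k hk).hom.app ⊤)
      (unitSectionLE (testMap P T' k) (testMod P T j' L) (V := ⊤) (U := ⊤) le_top (SecMod.val x))) := rfl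

omit [IsAffine T.left] [IsAffine T'.left] [IsAffine T''.left] in
/-- B-p10's `testAlgHom` is `testRingHom T' k` as a function. [cite: GortzWedhorn2023, Cor. 23.135 (p. 355)] -/
theorem testAlgHom_apply (x : Γ(T'.left, (⊤ : T'.left.Opens))) :
    letI := testAlgebra T j'; letI := testAlgebra T j''
    testAlgHom T j' j'' k hk x = testRingHom T' k x := rfl

end UnappliedForms

end Literature.AlgebraicGeometry.Modules

namespace Literature.AlgebraicGeometry.Motives

namespace SeesawSubscheme

open Literature.AlgebraicGeometry.Modules

/-! ### §B1 Generic instances: flatness / universal openness over a field, separatedness and affine Čech covers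
of `P ×_K T`, noetherianity of the chart ring -/

section Instances

variable {K : Type} [Field K]

/-- The structure morphism `Z → Spec K` of a scheme over a field is flat (every `K`-module is flat; as in
★ `Motives/FiniteQuotientProductDescent`). [cite: MumfordAV1970, §5 (pp. 46–47)] -/
theorem flat_hom_of_field (Z : SchemeOver K) : Flat Z.hom := by
  rw [IsZariskiLocalAtSource.iff_of_openCover (P := @Flat) Z.left.affineCover]
  intro i
  obtain ⟨φ, hφ⟩ := Spec.map_surjective (Z.left.affineCover.f i ≫ Z.hom)
  have hflat : Flat (Spec.map φ) := by
    rw [HasRingHomProperty.Spec_iff (P := @Flat)]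
    letI := φ.hom.toAlgebra
    exact RingHom.flat_algebraMap_iff.mpr (inferInstance : Module.Flat K _)
  rwa [hφ] at hflat

/-- A proper scheme over a field is universally open over it (flat and locally of finite presentation).
[cite: MumfordAV1970, §5 (pp. 46–47)] -/
theorem universallyOpen_hom_of_isProper (Z : SchemeOver K) [IsProper Z.hom] : UniversallyOpen Z.hom := by
  haveI : Flat Z.hom := flat_hom_of_field Z
  haveI : LocallyOfFinitePresentation Z.hom := inferInstance
  infer_instance

/-- `P ×_K T` is a separated scheme for `P → Spec K` separated and `T` affine. [cite: MumfordAV1970, §5 (pp. 46–47)] -/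
theorem isSeparated_tensor_left (P T : SchemeOver K) [IsSeparated P.hom] [IsAffine T.left] :
    (P ⊗ T).left.IsSeparated := by
  haveI : IsSeparated (snd P T).left := inferInstanceAs (IsSeparated (pullback.snd P.hom T.hom))
  constructor
  rw [show terminal.from (P ⊗ T).left = (snd P T).left ≫ terminal.from T.left from terminal.hom_ext _ _]
  infer_instance

/-- A nonempty finite intersection of affine opens of a separated scheme is affine (Mathlib `IsAffineOpen.inf`,
iterated; as ★ `Motives/GaloisDescentScheme.isAffineOpen_finset_inf`). [cite: MumfordAV1970, §5 (pp. 46–47)] -/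
theorem isAffineOpen_finset_inf' {Y : Scheme.{0}} [Y.IsSeparated] {ι : Type} (s : Finset ι) (hs : s.Nonempty)
    (V : ι → Y.Opens) (hV : ∀ i ∈ s, IsAffineOpen (V i)) : IsAffineOpen (s.inf V) := by
  classical
  induction hs using Finset.Nonempty.cons_induction with
  | singleton a => simpa using hV a (Finset.mem_singleton_self a)
  | cons a s ha hs ih =>
    rw [Finset.cons_eq_insert, Finset.inf_insert]
    exact (hV a (by simp)).inf (ih fun i hi ↦ hV i (by simp [hi]))

/-- A quasi-compact scheme has a finite affine open cover indexed by `Fin m` (as ★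
`Resolution/LogRegularAtlasGluing.exists_finite_affine_cover`). [cite: MumfordAV1970, §5 (pp. 46–47)] -/
theorem exists_finite_affine_cover' (Y : Scheme.{0}) [CompactSpace Y] :
    ∃ (m : ℕ) (V : Fin m → Y.affineOpens), ⨆ i, (V i : Y.Opens) = ⊤ := by
  obtain ⟨s, hs⟩ := isCompact_univ.elim_finite_subcover
    (fun V : Y.affineOpens => ((V : Y.Opens) : Set Y))
    (fun V => (V : Y.Opens).isOpen) (fun x _ => by
      obtain ⟨_, ⟨V, hV, rfl⟩, hxV, -⟩ :=
        Y.isBasis_affineOpens.exists_subset_of_mem_open (Set.mem_univ x) isOpen_univ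
      exact Set.mem_iUnion.mpr ⟨⟨V, hV⟩, hxV⟩)
  obtain ⟨m, ⟨e⟩⟩ := Finite.exists_equiv_fin (s : Set Y.affineOpens)
  refine ⟨m, fun i => (e.symm i).1, ?_⟩
  refine top_le_iff.mp fun x _ => ?_
  have hx := hs (Set.mem_univ x)
  simp only [Set.mem_iUnion] at hx
  obtain ⟨V, hV, hxV⟩ := hx
  exact Opens.mem_iSup.mpr ⟨e ⟨V, hV⟩, by simpa using hxV⟩

/-- **A finite affine open cover with affine finite intersections** of `P ×_K T` (`P` proper — hence
quasi-compact and separated — over `K`, `T` affine), indexed by `Fin n`. [cite: MumfordAV1970, §5 (pp. 46–47)] -/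
theorem exists_affine_cechCover (P T : SchemeOver K) [IsProper P.hom] [IsAffine T.left] :
    ∃ (n : ℕ) (𝓥 : Fin n → (P ⊗ T).left.Opens),
      (∀ s : Finset (Fin n), s.Nonempty → IsAffineOpen (cechOpen 𝓥 s)) ∧ ⨆ i, 𝓥 i = ⊤ := by
  haveI : (P ⊗ T).left.IsSeparated := isSeparated_tensor_left P T
  haveI : QuasiCompact (snd P T).left := inferInstanceAs (QuasiCompact (pullback.snd P.hom T.hom))
  haveI : CompactSpace (P ⊗ T).left := QuasiCompact.compactSpace_of_compactSpace (snd P T).left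
  obtain ⟨n, V, hV⟩ := exists_finite_affine_cover' (P ⊗ T).left
  exact ⟨n, fun i => (V i : (P ⊗ T).left.Opens),
    fun s hs => isAffineOpen_finset_inf' s hs _ fun i _ => (V i).2, hV⟩

end Instances
/-! ### §B2 The chart test objects: `T = Spec A → U ⊆ W`, `L = 𝓕_A`, ring identifications -/

section Chart

variable (X : SchemeOver ℂ) {W : SchemeOver ℂ} (𝓕 : (X ⊗ W).left.Modules) (U : W.left.affineOpens)

/-- `εB : B ≅ Γ(Spec B, 𝒪)`, the inverse of Mathlib's `ΓSpecIso`, as a ring isomorphism (non-Prop plumbing).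
[cite: MumfordAV1970, §5 (pp. 46–47)] -/
def εR (B : Type) [CommRing B] [Algebra Γ(W.left, U) B] :
    B ≃+* Γ((specTest U B).left, (⊤ : (specTest U B).left.Opens)) :=
  (Scheme.ΓSpecIso (.of B)).commRingCatIsoToRingEquiv.symm

/-- `εR` is `(ΓSpecIso B)⁻¹` as a function (unapplied form). [cite: MumfordAV1970, §5 (pp. 46–47)] -/
theorem εR_apply (B : Type) [CommRing B] [Algebra Γ(W.left, U) B] (b : B) :
    εR U B b = (Scheme.ΓSpecIso (.of B)).inv b := rfl

/-- `toTopRing = baseToTotal ∘ εB`. [cite: MumfordAV1970, §5 (pp. 46–47)] -/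
theorem toTopRing_eq_baseToTotal (B : Type) [CommRing B] [Algebra Γ(W.left, U) B] (b : B) :
    toTopRing X U B b = baseToTotal X (specTest U B) (εR U B b) := rfl

/-- The chart morphism `Spec B → Spec A` over `W` for an `A`-algebra `B`, `A = Γ(W, U)` (non-Prop plumbing).
[cite: MumfordAV1970, §5 (pp. 46–47)] -/
abbrev jTest (B : Type) [CommRing B] [Algebra Γ(W.left, U) B] : specTest U B ⟶ specTest U Γ(W.left, U) :=
  specTestMap U (Algebra.ofId Γ(W.left, U) B)

/-- **`εB ∘ algebraMap = j♯ ∘ εA`** (naturality of `ΓSpecIso`): the ring identifications intertwine the algebra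
structure of `B` and B-p10's `testAlgebra` structure of `Γ(Spec B, 𝒪)` over `Γ(Spec A, 𝒪)`. [cite: MumfordAV1970, §5 (pp. 46–47)] -/
theorem εR_algebraMap (B : Type) [CommRing B] [Algebra Γ(W.left, U) B] (a : Γ(W.left, U)) :
    εR U B (algebraMap Γ(W.left, U) B a) =
      Modules.testRingHom (specTest U Γ(W.left, U)) (jTest U B) (εR U Γ(W.left, U) a) := by
  have h := congrArg (fun f => f.hom a)
    (Scheme.ΓSpecIso_inv_naturality (CommRingCat.ofHom (algebraMap Γ(W.left, U) B)))
  simp only [CommRingCat.hom_comp, RingHom.comp_apply, CommRingCat.hom_ofHom] at h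
  rw [εR_apply, εR_apply, h]
  have e2 : (jTest U B).left.appLE ⊤ ⊤ le_top = (jTest U B).left.app ⊤ := (Scheme.Hom.app_eq_appLE _).symm
  change _ = ((jTest U B).left.appLE ⊤ ⊤ le_top).hom _
  rw [e2]
  rfl

/-- **`Spec φ ≫ (Spec B → Spec A) = (Spec C → Spec A)`** over `W` for an `A`-algebra map `φ : B → C`. [cite: MumfordAV1970, §5 (pp. 46–47)] -/
theorem specTestMap_comp_jTest {B C : Type} [CommRing B] [Algebra Γ(W.left, U) B] [CommRing C]
    [Algebra Γ(W.left, U) C] (φ : B →ₐ[Γ(W.left, U)] C) : specTestMap U φ ≫ jTest U B = jTest U C := by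
  ext : 1
  change Spec.map _ ≫ Spec.map _ = Spec.map _
  rw [← Spec.map_comp, ← CommRingCat.ofHom_comp]
  congr 2
  ext b
  exact (φ.commutes b)

/-- `Spec φ ≫ Spec(ofId B) = Spec(ofId C)` over `W` (B-p01's `FBIso` spelling of `specTestMap_comp_jTest`). [cite: MumfordAV1970, §5 (pp. 46–47)] -/
theorem specTestMap_comp_ofId {B C : Type} [CommRing B] [Algebra Γ(W.left, U) B] [CommRing C]
    [Algebra Γ(W.left, U) C] (φ : B →ₐ[Γ(W.left, U)] C) :
    specTestMap U φ ≫ specTestMap U (Algebra.ofId Γ(W.left, U) B) = specTestMap U (Algebra.ofId Γ(W.left, U) C) := by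
  ext : 1
  change Spec.map _ ≫ Spec.map _ = Spec.map _
  rw [← Spec.map_comp, ← CommRingCat.ofHom_comp]
  congr 2
  ext b
  exact (φ.commutes b)

/-- `(1 × Spec φ) ≫ (1 × Spec(ofId B)) = 1 × Spec(ofId C)` on total spaces. [cite: MumfordAV1970, §5 (pp. 46–47)] -/
theorem whiskerLeft_specTestMap_comp_ofId (X : SchemeOver ℂ) {B C : Type} [CommRing B] [Algebra Γ(W.left, U) B]
    [CommRing C] [Algebra Γ(W.left, U) C] (φ : B →ₐ[Γ(W.left, U)] C) :
    (X ◁ specTestMap U φ).left ≫ (X ◁ specTestMap U (Algebra.ofId Γ(W.left, U) B)).left =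
      (X ◁ specTestMap U (Algebra.ofId Γ(W.left, U) C)).left := by
  rw [← Over.comp_left, ← MonoidalCategory.whiskerLeft_comp, specTestMap_comp_ofId]

/-- `(1 × Spec(ofId B)) ≫ (1 × u_A) = 1 × u_B` on total spaces. [cite: MumfordAV1970, §5 (pp. 46–47)] -/
theorem whiskerLeft_ofId_comp_specTestHom (X : SchemeOver ℂ) (B : Type) [CommRing B] [Algebra Γ(W.left, U) B] :
    (X ◁ specTestMap U (Algebra.ofId Γ(W.left, U) B)).left ≫ (X ◁ specTestHom U Γ(W.left, U)).left =
      (X ◁ specTestHom U B).left := by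
  rw [← Over.comp_left, ← MonoidalCategory.whiskerLeft_comp, specTestMap_comp]

/-- `(1 × Spec φ) ≫ (1 × u_B) = 1 × u_C` on total spaces (the equation inside B-p01's `FBIso`). [cite: MumfordAV1970, §5 (pp. 46–47)] -/
theorem whiskerLeft_specTestMap_comp_specTestHom (X : SchemeOver ℂ) {B C : Type} [CommRing B]
    [Algebra Γ(W.left, U) B] [CommRing C] [Algebra Γ(W.left, U) C] (φ : B →ₐ[Γ(W.left, U)] C) :
    (X ◁ specTestMap U φ).left ≫ (X ◁ specTestHom U B).left = (X ◁ specTestHom U C).left := by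
  rw [← Over.comp_left, ← MonoidalCategory.whiskerLeft_comp, specTestMap_comp]

/-- **`εC ∘ φ = (Spec φ)♯ ∘ εB`** (naturality of `ΓSpecIso` along `φ`), with `(Spec φ)♯` in B-p10's `testRingHom` form.
[cite: MumfordAV1970, §5 (pp. 46–47)] -/
theorem εR_natural {B C : Type} [CommRing B] [Algebra Γ(W.left, U) B] [CommRing C] [Algebra Γ(W.left, U) C]
    (φ : B →ₐ[Γ(W.left, U)] C) (b : B) :
    εR U C (φ b) = Modules.testRingHom (specTest U B) (specTestMap U φ) (εR U B b) := by
  have h := congrArg (fun f => f.hom b) (Scheme.ΓSpecIso_inv_naturality (CommRingCat.ofHom (φ : B →+* C)))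
  simp only [CommRingCat.hom_comp, RingHom.comp_apply, CommRingCat.hom_ofHom] at h
  rw [εR_apply, εR_apply]
  refine (h : _).trans ?_
  have e2 : (specTestMap U φ).left.appLE ⊤ ⊤ le_top = (specTestMap U φ).left.app ⊤ :=
    (Scheme.Hom.app_eq_appLE _).symm
  change _ = ((specTestMap U φ).left.appLE ⊤ ⊤ le_top).hom _
  rw [e2]
  rfl

end Chart
/-! ### §B3 Noetherianity of the chart ring; local instances for B-p10's Grothendieck complex over the chart -/

section ChartInstances

variable (X : SchemeOver ℂ) {W : SchemeOver ℂ} (𝓕 : (X ⊗ W).left.Modules) (U : W.left.affineOpens)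

/-- `Γ(U, 𝒪_W)` is noetherian for `W` locally of finite type over `ℂ` and `U` affine. [cite: MumfordAV1970, §5 (pp. 46–47)] -/
theorem isNoetherianRing_chart [LocallyOfFiniteType W.hom] : IsNoetherianRing Γ(W.left, U) := by
  haveI : IsLocallyNoetherian W.left := LocallyOfFiniteType.isLocallyNoetherian W.hom
  exact IsLocallyNoetherian.component_noetherian U

/-- `Γ(Spec A, 𝒪)` is noetherian, `A = Γ(U, 𝒪_W)`. [cite: MumfordAV1970, §5 (pp. 46–47)] -/
theorem isNoetherianRing_ΓSpec_chart [LocallyOfFiniteType W.hom] :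
    IsNoetherianRing Γ((specTest U Γ(W.left, U)).left, (⊤ : (specTest U Γ(W.left, U)).left.Opens)) := by
  haveI := isNoetherianRing_chart U
  exact isNoetherianRing_of_ringEquiv Γ(W.left, U) (εR U Γ(W.left, U))

/-- `Spec A` is locally noetherian, `A = Γ(U, 𝒪_W)`. [cite: MumfordAV1970, §5 (pp. 46–47)] -/
theorem isLocallyNoetherian_specTest_chart [LocallyOfFiniteType W.hom] :
    IsLocallyNoetherian (specTest U Γ(W.left, U)).left := by
  haveI := isNoetherianRing_chart U
  exact inferInstanceAs (IsLocallyNoetherian (Spec (.of Γ(W.left, U))))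

/-- `toSections ρ ⊤ = ρ` (restriction along `⊤ ≤ ⊤` is the identity). [cite: MumfordAV1970, §5 (pp. 46–47)] -/
theorem toSections_top_apply {Y : Scheme.{0}} {R : Type} [CommRing R] (ρ : R →+* Γ(Y, (⊤ : Y.Opens))) (r : R) :
    toSections ρ ⊤ r = ρ r := by
  change (Y.presheaf.map (homOfLE _).op).hom (ρ r) = ρ r
  have : (homOfLE (le_top : (⊤ : Y.Opens) ≤ ⊤)) = 𝟙 _ := Subsingleton.elim _ _
  rw [this, op_id, CategoryTheory.Functor.map_id]
  rfl

end ChartInstances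
/-! ### §B4 Generic: sections of an isomorphic module as `SecMod`; the `SecMod` scalar action at `⊤` -/

section GenericSecMod

variable {Y : Scheme.{0}} {R : Type} [CommRing R] (ρ : R →+* Γ(Y, (⊤ : Y.Opens))) {M N : Y.Modules}

/-- **`Γ(N, ⊤) ≅ SecMod M ρ ⊤` along `e : M ≅ N`** (additive; stated for VARIABLE modules so that every kernel
conversion stops at a free variable; non-Prop plumbing). [cite: MumfordAV1970, §5 (pp. 46–47)] -/
def secModOfIso (e : M ≅ N) : Γ(N, (⊤ : Y.Opens)) ≃+ SecMod M ρ ⊤ where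
  toFun s := (e.inv.app ⊤ s : Γ(M, (⊤ : Y.Opens)))
  invFun x := e.hom.app ⊤ (x : Γ(M, (⊤ : Y.Opens)))
  left_inv s := hom_app_inv_app e ⊤ s
  right_inv x := inv_app_hom_app e ⊤ x
  map_add' s t := (((e.inv).val.app (.op ⊤)).hom.map_add s t : _)

/-- The forward map (unapplied form). [cite: MumfordAV1970, §5 (pp. 46–47)] -/
theorem coe_secModOfIso (e : M ≅ N) :
    ⇑(secModOfIso ρ e) = fun s => (e.inv.app ⊤ s : Γ(M, (⊤ : Y.Opens))) := rfl

/-- The backward map (unapplied form). [cite: MumfordAV1970, §5 (pp. 46–47)] -/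
theorem coe_secModOfIso_symm (e : M ≅ N) :
    ⇑(secModOfIso ρ e).symm = fun x => e.hom.app ⊤ (x : Γ(M, (⊤ : Y.Opens))) := rfl

/-- The underlying section of `secModOfIso ρ e s`. [cite: MumfordAV1970, §5 (pp. 46–47)] -/
theorem val_secModOfIso (e : M ≅ N) (s : Γ(N, (⊤ : Y.Opens))) :
    SecMod.val (secModOfIso ρ e s) = e.inv.app ⊤ s := rfl

/-- At `⊤` the `R`-action on `SecMod M ρ ⊤` is `b • x = ρ b • x`. [cite: MumfordAV1970, §5 (pp. 46–47)] -/
theorem SecMod.val_smul_top (b : R) (x : SecMod M ρ ⊤) :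
    SecMod.val (b • x) = ρ b • SecMod.val x := by
  rw [SecMod.smul_def, toSections_top_apply]

/-- `secModOfIso` carries the `Γ(Y, 𝒪)`-action on `Γ(N, ⊤)` to the `R`-action on `SecMod` along `ρ`:
`e⁻¹(ρ b • s) = b • e⁻¹(s)`. [cite: MumfordAV1970, §5 (pp. 46–47)] -/
theorem secModOfIso_smul (e : M ≅ N) (b : R) (s : Γ(N, (⊤ : Y.Opens))) :
    secModOfIso ρ e (ρ b • s) = b • secModOfIso ρ e s := by
  apply SecMod.val_injective
  rw [SecMod.val_smul_top, val_secModOfIso, val_secModOfIso, Scheme.Modules.Hom.app_smul]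

end GenericSecMod

end SeesawSubscheme

end Literature.AlgebraicGeometry.Motives

end
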